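import Mathlib
import Summits.ValiantsHypothesis.ValiantsHypothesis.Theses.BarrierLever
import Summits.ValiantsHypothesis.ValiantsHypothesis.Theorems.BarrierLeverDefinableEquationsCoefficientFunction
import Summits.ValiantsHypothesis.ValiantsHypothesis.Theorems.BarrierLeverDefinableEquationsCoefficientExtraction
import Summits.ValiantsHypothesis.ValiantsHypothesis.Theorems.BarrierLeverDefinableEquationsTopEquations
import Summits.ValiantsHypothesis.ValiantsHypothesis.Theorems.BarrierLeverDefinableEquationsLevelOne

/-!
# Crux `BarrierLever.DefinableEquations` (stmt-8745) / item `SingleSizeEquations` (stmt-8749) —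
# NORMAL FORM: the crux is EQUIVALENT to the existence of equations for the degree-`n` forms of
# size `n^b` whose COEFFICIENT FUNCTION is poly(`N`)-explicit (val-np-p5 g7)

"Explicit" = the exact algebraic rendering of "`#P/poly` at scale `N = C(2n,n)`": the coefficient
`coeff_m E` of the monomial `X^m` (exponent function `m` on the top monomials, one-hot encoded on
the bits `topMonomials n × Fin (D+1)`) is the Boolean-cube marginal
`∑_{w ∈ {0,1}^r} Q₀(oneHot m, w)` of ONE polynomial `Q₀` ON BITS ONLY, with
`D, r, L(Q₀), deg Q₀ ≤ N^c`.

* `definableEquations_iff_explicitCoefficients` — **`DefinableEquations ↔ ∃ c ∀ b`, eventually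
  in `n`, a nonzero `E ∈ ℂ[topMonomials n]` with `N^c`-explicit coefficient function vanishing at
  the top component of every `f ∈ SmallCircuits ℂ n b`.**
* `singleSizeEquations_iff_explicitCoefficients` — the same with `c` depending on `b` (item 8749).
* pointwise: `CoefficientCrux.topEq_of_explicit` (level `2c+7` from scale `c`, by Valiant's
  criterion `CoefficientFunction.exists_witness`) and `CoefficientCrux.explicit_of_topEq` (scale
  `2a+7` from level `a`, by the extraction `CoefficientExtraction.exists_coeffPoly`).

`→` uses the top-component normal form (`definableEquations_iff_topEquations`) and coefficient
extraction (multivariate DFT, one copy of the witness); `←` is Valiant's criterion.  So the crux —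
Chatterjee–Tengse's open direction 2 (arXiv:2309.07612 §1.3) in the tree's format — is now literally
a question about COEFFICIENT FUNCTIONS of equations of `{top(f) : deg f ≤ n, L(f) ≤ n^b}`, with no
circuit or Boolean sum over the coefficient variables left in it: find, uniformly in `b`, nonzero
equations whose coefficient function is a poly(`N`)-size cube marginal.  Known unconditionally:
coefficient functions computable by quasi-poly(`N`) linear algebra (`quasiPolyEquations`) /
`PSPACE`-style succinct determinants (CT23 Thm 1.3); the crux stays OPEN and nothing here bears on
`VP ≠ VNP`.  No definitions, no named facts.  Refs: Bürgisser 2000, Prop. 2.20 / §2.3; Valiant 1979;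
Chatterjee–Tengse 2023 §1.3.
-/

set_option linter.dupNamespace false

noncomputable section

namespace Summit.ValiantsHypothesis.ValiantsHypothesis.Theorems.BarrierLeverDefinableEquations

open MvPolynomial Literature.Computability.AlgebraicComplexity
open Literature.Barriers.ValiantsHypothesis
open scoped BigOperators

namespace CoefficientCrux

/-! ### Exponent-vector sums and their coefficients (generic finite variable type) -/

section Generic

variable {ι : Type*} [Fintype ι]

/-- Substituting constants: `aeval (C ∘ g) p = C (eval g p)`. [folklore] -/
theorem aeval_C_comp {σ τ : Type*} (g : σ → ℂ) (p : MvPolynomial σ ℂ) :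
    aeval (fun x => (C (g x) : MvPolynomial τ ℂ)) p = C (eval g p) := by
  induction p using MvPolynomial.induction_on with
  | C a => rw [aeval_C, eval_C, algebraMap_eq]
  | add p q hp hq => rw [map_add, map_add, hp, hq, map_add]
  | mul_X p n hp => rw [map_mul, map_mul, hp, aeval_X, eval_X, map_mul]

/-- **Coefficients of an exponent-vector sum**: the coefficient of `X^m` in
`∑_{m'} C (φ m') ∏_e X_e^{m' e}` is `φ` at (the `Fin (D+1)`-valued version of) `m` if all
exponents of `m` are `≤ D`, and `0` otherwise. [folklore] -/
theorem coeff_expSum [DecidableEq ι] (D : ℕ) (φ : (ι → Fin (D + 1)) → ℂ) (m : ι →₀ ℕ) :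
    coeff m (∑ m' : ι → Fin (D + 1), C (φ m') * ∏ e : ι, (X e : MvPolynomial ι ℂ) ^ (m' e : ℕ)) =
      if h : ∀ e, m e ≤ D then φ (fun e => ⟨m e, Nat.lt_succ_of_le (h e)⟩) else 0 := by
  classical
  have hmono : ∀ m' : ι → Fin (D + 1),
      C (φ m') * ∏ e : ι, (X e : MvPolynomial ι ℂ) ^ (m' e : ℕ) =
        monomial (Finsupp.equivFunOnFinite.symm fun e => (m' e : ℕ)) (φ m') := fun m' => by
    rw [monomial_eq, Finsupp.prod_fintype _ _ fun e => pow_zero _]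
    simp only [Finsupp.coe_equivFunOnFinite_symm]
  simp_rw [hmono]
  rw [coeff_sum]
  simp_rw [coeff_monomial]
  split_ifs with h
  · rw [Finset.sum_eq_single (fun e => ⟨m e, Nat.lt_succ_of_le (h e)⟩)]
    · rw [if_pos]
      ext e; simp
    · intro m' _ hm'
      rw [if_neg]
      intro heq
      apply hm'
      funext e
      have h1 := DFunLike.congr_fun heq e
      simp only [Finsupp.coe_equivFunOnFinite_symm] at h1
      exact Fin.ext h1
    · exact fun h' => absurd (Finset.mem_univ _) h'
  · refine Finset.sum_eq_zero fun m' _ => if_neg fun heq => h fun e => ?_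
    have h1 := DFunLike.congr_fun heq e
    simp only [Finsupp.coe_equivFunOnFinite_symm] at h1
    rw [← h1]
    exact Nat.lt_succ_iff.mp (m' e).2

/-- **A polynomial with an explicit coefficient function is an exponent-vector sum.** [folklore] -/
theorem eq_expSum_of_coeff [DecidableEq ι] (D : ℕ) (φ : (ι → Fin (D + 1)) → ℂ)
    (E : MvPolynomial ι ℂ)
    (hE : ∀ m : ι →₀ ℕ, coeff m E =
      if h : ∀ e, m e ≤ D then φ (fun e => ⟨m e, Nat.lt_succ_of_le (h e)⟩) else 0) :
    E = ∑ m' : ι → Fin (D + 1), C (φ m') * ∏ e : ι, (X e : MvPolynomial ι ℂ) ^ (m' e : ℕ) := by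
  refine MvPolynomial.ext _ _ fun m => ?_
  rw [hE m, coeff_expSum]

end Generic

/-! ### Pointwise: explicit coefficient function ⟺ top witness -/

/-- The one-hot bit vector of `m : topMonomials n →₀ ℕ` compared through `ℕ` equals the graph of
its `Fin (D+1)`-valued version. [folklore] -/
theorem bits_eq {ι : Type*} {D : ℕ} (m : ι →₀ ℕ) (h : ∀ e, m e ≤ D) :
    (fun p : ι × Fin (D + 1) => decide (m p.1 = (p.2 : ℕ))) =
      fun p : ι × Fin (D + 1) =>
        decide ((fun e => (⟨m e, Nat.lt_succ_of_le (h e)⟩ : Fin (D + 1))) p.1 = p.2) := by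
  funext p
  simp [Fin.ext_iff]

/-- Level arithmetic for both directions (`n ≥ 2`, so `N ≥ 3` and `#topMonomials n ≤ N`).
[folklore] -/
theorem arith {N a I x y z : ℕ} (hN : 3 ≤ N) (hI : I ≤ N) (hx : x ≤ N ^ a) (hy : y ≤ N ^ a)
    (hz : z ≤ N ^ a) :
    x + I * (N ^ a + 1) ≤ N ^ (2 * a + 7) ∧ I * (N ^ a + 1) + x ≤ N ^ (2 * a + 7) ∧
      y + 8 * (I + 1) * (N ^ a + 2) ^ 2 ≤ N ^ (2 * a + 7) ∧
      z * (N ^ a + 1) + I * (N ^ a + 2) ≤ N ^ (2 * a + 7) ∧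
      z + 2 * (I + 1) * (N ^ a + 2) ≤ N ^ (2 * a + 7) ∧ N ^ a ≤ N ^ (2 * a + 7) := by
  have hN0 : 0 < N := by omega
  have hmono : ∀ {i j : ℕ}, i ≤ j → N ^ i ≤ N ^ j := fun h => Nat.pow_le_pow_right hN0 h
  have hA1 : 1 ≤ N ^ a := Nat.one_le_pow _ _ hN0
  have hI1 : I + 1 ≤ N ^ 2 := by nlinarith
  have hP : N ^ a + 2 ≤ N ^ (a + 1) := by
    calc N ^ a + 2 ≤ 3 * N ^ a := by omega
      _ ≤ N * N ^ a := Nat.mul_le_mul_right _ hN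
      _ = N ^ (a + 1) := by ring
  have hP1 : N ^ a + 1 ≤ N ^ (a + 1) := by omega
  have h8 : 8 ≤ N ^ 2 := by nlinarith
  -- the dominant term
  have hbig : 8 * (I + 1) * (N ^ a + 2) ^ 2 ≤ N ^ (2 * a + 6) := by
    calc 8 * (I + 1) * (N ^ a + 2) ^ 2 ≤ N ^ 2 * N ^ 2 * (N ^ (a + 1)) ^ 2 := by
          gcongr
      _ = N ^ (2 * a + 6) := by ring
  have htop : 2 * N ^ (2 * a + 6) ≤ N ^ (2 * a + 7) := by
    calc 2 * N ^ (2 * a + 6) ≤ N * N ^ (2 * a + 6) := Nat.mul_le_mul_right _ (by omega)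
      _ = N ^ (2 * a + 7) := by ring
  have h26 : N ^ a ≤ N ^ (2 * a + 6) := hmono (by omega)
  have hIx : I * (N ^ a + 1) ≤ N ^ (2 * a + 6) := by
    calc I * (N ^ a + 1) ≤ N * N ^ (a + 1) := Nat.mul_le_mul hI hP1
      _ = N ^ (a + 2) := by ring
      _ ≤ N ^ (2 * a + 6) := hmono (by omega)
  have hzz : z * (N ^ a + 1) + I * (N ^ a + 2) ≤ 2 * N ^ (2 * a + 6) := by
    calc z * (N ^ a + 1) + I * (N ^ a + 2) ≤ N ^ a * N ^ (a + 1) + N * N ^ (a + 1) := by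
          gcongr
      _ = N ^ (2 * a + 1) + N ^ (a + 2) := by ring
      _ ≤ N ^ (2 * a + 6) + N ^ (2 * a + 6) := Nat.add_le_add (hmono (by omega)) (hmono (by omega))
      _ = 2 * N ^ (2 * a + 6) := by ring
  have h2I : 2 * (I + 1) * (N ^ a + 2) ≤ N ^ (2 * a + 6) := by
    calc 2 * (I + 1) * (N ^ a + 2) ≤ N * N ^ 2 * N ^ (a + 1) := by gcongr; omega
      _ = N ^ (a + 4) := by ring
      _ ≤ N ^ (2 * a + 6) := hmono (by omega)
  refine ⟨?_, ?_, ?_, ?_, ?_, hmono (by omega)⟩ <;> omega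

/-- **Explicit coefficient function ⇒ top witness** (`n ≥ 2`; scale `c` ⇒ level `2c + 7`), by
Valiant's criterion in exponent-vector form (`CoefficientFunction.exists_witness`).
[cite: Burgisser2000, Prop. 2.20] -/
theorem topEq_of_explicit {c b n : ℕ} (hn : 2 ≤ n)
    (h : ∃ D r : ℕ, D ≤ (Nat.choose (2 * n) n) ^ c ∧ r ≤ (Nat.choose (2 * n) n) ^ c ∧
      ∃ Q₀ : MvPolynomial ((↥(topMonomials n) × Fin (D + 1)) ⊕ Fin r) ℂ,
        complexity Q₀ ≤ (Nat.choose (2 * n) n) ^ c ∧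
        Q₀.totalDegree ≤ (Nat.choose (2 * n) n) ^ c ∧
        ∃ E : MvPolynomial ↥(topMonomials n) ℂ, E ≠ 0 ∧
          (∀ f ∈ SmallCircuits ℂ n b,
            eval (fun e : topMonomials n => coeff (e : Fin n →₀ ℕ) f) E = 0) ∧
          (∀ m ∈ E.support, ∀ e, m e ≤ D) ∧
          ∀ m : ↥(topMonomials n) →₀ ℕ, (∀ e, m e ≤ D) → coeff m E =
            ∑ w : Fin r → Bool, eval (fun x => if Sum.elim
              (fun p : ↥(topMonomials n) × Fin (D + 1) => decide (m p.1 = (p.2 : ℕ))) w x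
              then (1 : ℂ) else 0) Q₀) :
    ∃ q : ℕ, q ≤ (Nat.choose (2 * n) n) ^ (2 * c + 7) ∧
      ∃ H : MvPolynomial (↥(topMonomials n) ⊕ Fin q) ℂ,
        complexity H ≤ (Nat.choose (2 * n) n) ^ (2 * c + 7) ∧
        H.totalDegree ≤ (Nat.choose (2 * n) n) ^ (2 * c + 7) ∧
        boolSum H ≠ 0 ∧
        ∀ f ∈ SmallCircuits ℂ n b,
          eval (fun e : topMonomials n => coeff (e : Fin n →₀ ℕ) f) (boolSum H) = 0 := by
  classical
  haveI : Fintype (topMonomials n) := (Finsupp.finite_of_degree_eq (σ := Fin n) n).fintype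
  obtain ⟨D, r, hD, hr, Q₀, hQc, hQd, E, hE0, hvan, hsupp, hcoeff⟩ := h
  set N : ℕ := Nat.choose (2 * n) n with hNdef
  -- Valiant's criterion for `Q := Q₀` lifted to the coefficient variables
  obtain ⟨H, hsum, hHc, hHd⟩ := CoefficientFunction.exists_witness (ι := ↥(topMonomials n)) D r
    (rename Sum.inr Q₀)
  -- the Boolean sum IS `E`
  have hφ : ∀ (m : ↥(topMonomials n) → Fin (D + 1)) (w : Fin r → Bool),
      aeval (boolPt (Sum.elim (fun p : ↥(topMonomials n) × Fin (D + 1) => decide (m p.1 = p.2)) w))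
        (rename Sum.inr Q₀) =
        C (eval (fun x => if Sum.elim
          (fun p : ↥(topMonomials n) × Fin (D + 1) => decide (m p.1 = p.2)) w x
          then (1 : ℂ) else 0) Q₀) := fun m w => by
    rw [aeval_rename, ← aeval_C_comp]
    have hfg : (boolPt (σ := ↥(topMonomials n))
        (Sum.elim (fun p : ↥(topMonomials n) × Fin (D + 1) => decide (m p.1 = p.2)) w)) ∘ Sum.inr =
        fun x => C (if Sum.elim
          (fun p : ↥(topMonomials n) × Fin (D + 1) => decide (m p.1 = p.2)) w x
          then (1 : ℂ) else 0) := by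
      funext x
      by_cases hx : Sum.elim (fun p : ↥(topMonomials n) × Fin (D + 1) => decide (m p.1 = p.2)) w x
      · simp only [Function.comp_apply, boolPt, Sum.elim_inr, hx, if_true, map_one]
      · have hx' : Sum.elim (fun p : ↥(topMonomials n) × Fin (D + 1) => decide (m p.1 = p.2)) w x =
            false := by simpa using hx
        simp [boolPt, hx']
    rw [hfg]
  have hEsum : boolSum H = E := by
    rw [hsum]
    have hstep : ∀ m : ↥(topMonomials n) → Fin (D + 1),
        (∑ w : Fin r → Bool,
          aeval (boolPt (Sum.elim
            (fun p : ↥(topMonomials n) × Fin (D + 1) => decide (m p.1 = p.2)) w))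
              (rename Sum.inr Q₀) *
            ∏ e : ↥(topMonomials n), (X e : MvPolynomial ↥(topMonomials n) ℂ) ^ (m e : ℕ)) =
        C (∑ w : Fin r → Bool, eval (fun x => if Sum.elim
            (fun p : ↥(topMonomials n) × Fin (D + 1) => decide (m p.1 = p.2)) w x
            then (1 : ℂ) else 0) Q₀) *
          ∏ e : ↥(topMonomials n), (X e : MvPolynomial ↥(topMonomials n) ℂ) ^ (m e : ℕ) := by
      intro m
      rw [map_sum, Finset.sum_mul]
      exact Finset.sum_congr rfl fun w _ => by rw [hφ m w]
    rw [Finset.sum_congr rfl fun m _ => hstep m]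
    symm
    refine eq_expSum_of_coeff D _ E fun m => ?_
    by_cases hm : ∀ e, m e ≤ D
    · rw [hcoeff m hm, dif_pos hm, bits_eq m hm]
    · rw [dif_neg hm]
      exact notMem_support_iff.mp fun hmem => hm (hsupp m hmem)
  -- levels
  have hnN : 2 * n ≤ N := by
    have h1 := Nat.choose_le_middle 1 (2 * n)
    rwa [Nat.choose_one_right, Nat.mul_div_cancel_left n Nat.two_pos] at h1
  have hN3 : 3 ≤ N := by omega
  have hI : Fintype.card ↥(topMonomials n) ≤ N := SelGadget.card_topMonomials_le n
  obtain ⟨-, hq, hL, -, hd, -⟩ := arith (z := Q₀.totalDegree) hN3 hI hr hQc hQd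
  refine ⟨Fintype.card ↥(topMonomials n) * (D + 1) + r, ?_, H, ?_, ?_, ?_, ?_⟩
  · exact le_trans (by gcongr) hq
  · refine hHc.trans (le_trans ?_ hL)
    have := complexity_rename_le_holds' (Sum.inr : _ → ↥(topMonomials n) ⊕ _) Q₀
    gcongr
  · refine hHd.trans (le_trans ?_ hd)
    have := totalDegree_rename_le (Sum.inr : _ → ↥(topMonomials n) ⊕ _) Q₀
    gcongr
  · rw [hEsum]; exact hE0
  · intro f hf; rw [hEsum]; exact hvan f hf

/-- **Top witness ⇒ explicit coefficient function** (`n ≥ 2`; level `a` ⇒ scale `2a + 7`), by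
coefficient extraction (`CoefficientExtraction.exists_coeffPoly`, `D = N^a`).
[cite: Burgisser2000, Prop. 2.20] -/
theorem explicit_of_topEq {a b n : ℕ} (hn : 2 ≤ n)
    (h : ∃ q : ℕ, q ≤ (Nat.choose (2 * n) n) ^ a ∧
      ∃ H : MvPolynomial (↥(topMonomials n) ⊕ Fin q) ℂ,
        complexity H ≤ (Nat.choose (2 * n) n) ^ a ∧ H.totalDegree ≤ (Nat.choose (2 * n) n) ^ a ∧
        boolSum H ≠ 0 ∧
        ∀ f ∈ SmallCircuits ℂ n b,
          eval (fun e : topMonomials n => coeff (e : Fin n →₀ ℕ) f) (boolSum H) = 0) :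
    ∃ D r : ℕ, D ≤ (Nat.choose (2 * n) n) ^ (2 * a + 7) ∧ r ≤ (Nat.choose (2 * n) n) ^ (2 * a + 7) ∧
      ∃ Q₀ : MvPolynomial ((↥(topMonomials n) × Fin (D + 1)) ⊕ Fin r) ℂ,
        complexity Q₀ ≤ (Nat.choose (2 * n) n) ^ (2 * a + 7) ∧
        Q₀.totalDegree ≤ (Nat.choose (2 * n) n) ^ (2 * a + 7) ∧
        ∃ E : MvPolynomial ↥(topMonomials n) ℂ, E ≠ 0 ∧
          (∀ f ∈ SmallCircuits ℂ n b,
            eval (fun e : topMonomials n => coeff (e : Fin n →₀ ℕ) f) E = 0) ∧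
          (∀ m ∈ E.support, ∀ e, m e ≤ D) ∧
          ∀ m : ↥(topMonomials n) →₀ ℕ, (∀ e, m e ≤ D) → coeff m E =
            ∑ w : Fin r → Bool, eval (fun x => if Sum.elim
              (fun p : ↥(topMonomials n) × Fin (D + 1) => decide (m p.1 = (p.2 : ℕ))) w x
              then (1 : ℂ) else 0) Q₀ := by
  classical
  haveI : Fintype (topMonomials n) := (Finsupp.finite_of_degree_eq (σ := Fin n) n).fintype
  obtain ⟨q, hq, H, hHc, hHd, hne, hvan⟩ := h
  set N : ℕ := Nat.choose (2 * n) n with hNdef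
  -- `deg (boolSum H) ≤ deg H ≤ N^a`
  have hdeg : (boolSum H).totalDegree ≤ N ^ a := by
    refine le_trans ?_ hHd
    unfold boolSum
    refine totalDegree_finsetSum_le fun e _ => ?_
    rw [show aeval (Sum.elim X fun j => if e j then (1 : MvPolynomial ↥(topMonomials n) ℂ) else 0)
        H = bind₁ (Sum.elim X fun j => if e j then (1 : MvPolynomial ↥(topMonomials n) ℂ) else 0) H
        from rfl]
    refine (FSV2018.totalDegree_bind₁_le_mul _ 1 (fun v => ?_) H).trans (by rw [mul_one])
    rcases v with i | j
    · rw [Sum.elim_inl, totalDegree_X]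
    · simp only [Sum.elim_inr]
      split_ifs
      · rw [totalDegree_one]; exact Nat.zero_le _
      · rw [totalDegree_zero]; exact Nat.zero_le _
  obtain ⟨Q₀, hsum, hQc, hQd⟩ :=
    CoefficientExtraction.exists_coeffPoly (ι := ↥(topMonomials n)) (N ^ a) H hdeg
  have hnN : 2 * n ≤ N := by
    have h1 := Nat.choose_le_middle 1 (2 * n)
    rwa [Nat.choose_one_right, Nat.mul_div_cancel_left n Nat.two_pos] at h1
  have hN3 : 3 ≤ N := by omega
  have hI : Fintype.card ↥(topMonomials n) ≤ N := SelGadget.card_topMonomials_le n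
  obtain ⟨hr, -, hL, hd, -, hD⟩ := arith (x := q) hN3 hI hq hHc hHd
  refine ⟨N ^ a, q + Fintype.card ↥(topMonomials n) * (N ^ a + 1), hD, hr, Q₀, hQc.trans hL,
    hQd.trans hd, boolSum H, hne, hvan,
    fun m hm => CoefficientExtraction.apply_le_of_mem_support hdeg hm, fun m hm => ?_⟩
  rw [← hsum, coeff_expSum, dif_pos hm, bits_eq m hm]

end CoefficientCrux

open CoefficientCrux

/-- **NORMAL FORM — the crux is equivalent to the existence of equations with poly(`N`)-EXPLICIT
COEFFICIENT FUNCTIONS.**  `DefinableEquations` holds iff for some `c`, for every size exponent `b`,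
eventually in `n`, there are `D, r ≤ N^c`, a polynomial `Q₀` ON BITS (`topMonomials n × Fin (D+1)`
one-hot exponent bits and `r` auxiliary bits) with `L(Q₀), deg Q₀ ≤ N^c`, and a NONZERO
`E ∈ ℂ[topMonomials n]` vanishing at the top component of every `f ∈ SmallCircuits ℂ n b` whose
coefficient function is the cube marginal of `Q₀`: exponents of `E` are `≤ D` and
`coeff_m E = ∑_{w ∈ {0,1}^r} Q₀(oneHot m, w)` for every such `m`.  (`→`: top normal form +
coefficient extraction; `←`: Valiant's criterion.) [cite: Burgisser2000, Prop. 2.20] -/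
theorem definableEquations_iff_explicitCoefficients :
    Summit.ValiantsHypothesis.ValiantsHypothesis.Theses.BarrierLever.DefinableEquations ↔
    ∃ c : ℕ, ∀ b : ℕ, ∃ n₀ : ℕ, ∀ n ≥ n₀,
      ∃ D r : ℕ, D ≤ (Nat.choose (2 * n) n) ^ c ∧ r ≤ (Nat.choose (2 * n) n) ^ c ∧
      ∃ Q₀ : MvPolynomial ((↥(topMonomials n) × Fin (D + 1)) ⊕ Fin r) ℂ,
        complexity Q₀ ≤ (Nat.choose (2 * n) n) ^ c ∧
        Q₀.totalDegree ≤ (Nat.choose (2 * n) n) ^ c ∧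
        ∃ E : MvPolynomial ↥(topMonomials n) ℂ, E ≠ 0 ∧
          (∀ f ∈ SmallCircuits ℂ n b,
            eval (fun e : topMonomials n => coeff (e : Fin n →₀ ℕ) f) E = 0) ∧
          (∀ m ∈ E.support, ∀ e, m e ≤ D) ∧
          ∀ m : ↥(topMonomials n) →₀ ℕ, (∀ e, m e ≤ D) → coeff m E =
            ∑ w : Fin r → Bool, eval (fun x => if Sum.elim
              (fun p : ↥(topMonomials n) × Fin (D + 1) => decide (m p.1 = (p.2 : ℕ))) w x
              then (1 : ℂ) else 0) Q₀ := by
  rw [definableEquations_iff_topEquations]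
  constructor
  · rintro ⟨a, ha⟩
    refine ⟨2 * a + 7, fun b => ?_⟩
    obtain ⟨n₀, hn₀⟩ := ha b
    refine ⟨max n₀ 2, fun n hn => ?_⟩
    exact explicit_of_topEq (le_trans (le_max_right _ _) hn)
      (hn₀ n (le_trans (le_max_left _ _) hn))
  · rintro ⟨c, hc⟩
    refine ⟨2 * c + 7, fun b => ?_⟩
    obtain ⟨n₀, hn₀⟩ := hc b
    refine ⟨max n₀ 2, fun n hn => ?_⟩
    exact topEq_of_explicit (le_trans (le_max_right _ _) hn)
      (hn₀ n (le_trans (le_max_left _ _) hn))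

/-- **Item 8749 in the same normal form** (`c` may depend on `b`): `SingleSizeEquations` holds iff
for every `b` there is a scale `c` at which, eventually in `n`, a nonzero equation of the top
components of `SmallCircuits ℂ n b` has an `N^c`-explicit coefficient function.
[cite: Burgisser2000, Prop. 2.20] -/
theorem singleSizeEquations_iff_explicitCoefficients :
    Summit.ValiantsHypothesis.ValiantsHypothesis.Theses.BarrierLever.SingleSizeEquations ↔
    ∀ b : ℕ, ∃ c n₀ : ℕ, ∀ n ≥ n₀,
      ∃ D r : ℕ, D ≤ (Nat.choose (2 * n) n) ^ c ∧ r ≤ (Nat.choose (2 * n) n) ^ c ∧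
      ∃ Q₀ : MvPolynomial ((↥(topMonomials n) × Fin (D + 1)) ⊕ Fin r) ℂ,
        complexity Q₀ ≤ (Nat.choose (2 * n) n) ^ c ∧
        Q₀.totalDegree ≤ (Nat.choose (2 * n) n) ^ c ∧
        ∃ E : MvPolynomial ↥(topMonomials n) ℂ, E ≠ 0 ∧
          (∀ f ∈ SmallCircuits ℂ n b,
            eval (fun e : topMonomials n => coeff (e : Fin n →₀ ℕ) f) E = 0) ∧
          (∀ m ∈ E.support, ∀ e, m e ≤ D) ∧
          ∀ m : ↥(topMonomials n) →₀ ℕ, (∀ e, m e ≤ D) → coeff m E =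
            ∑ w : Fin r → Bool, eval (fun x => if Sum.elim
              (fun p : ↥(topMonomials n) × Fin (D + 1) => decide (m p.1 = (p.2 : ℕ))) w x
              then (1 : ℂ) else 0) Q₀ := by
  rw [← definableEquations_iff_singleSizeEquations, definableEquations_iff_explicitCoefficients]
  constructor
  · rintro ⟨c, hc⟩ b
    obtain ⟨n₀, hn₀⟩ := hc b
    exact ⟨c, n₀, hn₀⟩
  · intro h
    -- `∀ b ∃ c` ⇒ `SingleSizeEquations` ⇒ `DefinableEquations` ⇒ `∃ c ∀ b` (dilation, tree theorem)
    have hsse :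
        Summit.ValiantsHypothesis.ValiantsHypothesis.Theses.BarrierLever.SingleSizeEquations := by
      intro b
      obtain ⟨c, n₀, hn₀⟩ := h b
      refine ⟨2 * c + 7, max n₀ 2, fun n hn => ?_⟩
      exact TopEquations.eq_of_topEq (topEq_of_explicit (le_trans (le_max_right _ _) hn)
        (hn₀ n (le_trans (le_max_left _ _) hn)))
    exact (definableEquations_iff_explicitCoefficients.mp
      (definableEquations_iff_singleSizeEquations.mpr hsse))

end Summit.ValiantsHypothesis.ValiantsHypothesis.Theorems.BarrierLeverDefinableEquations

end
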